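import Summits.QuantumFields.YangMills.Theorems.UnitScaleTiltProp7TransplantGen0Numbers
import Summits.QuantumFields.YangMills.Theorems.UnitScaleTiltProp7TransplantNormsField
import Summits.QuantumFields.YangMills.Theorems.UnitScaleTiltProp7TransplantBumpRows
import HarnessLib

/-!
# Route `UnitScaleTilt`, crux K1 «MinimiserStabilityRegPr» (stmt-QuantumFields-19200), route-R E′ path (α′), (E1-b) at the CURVED background, (A-cov) gen-1, FILE A «GEN-1 ENGINES»:
# (A1) the `ω²`-weighted `hs`-number of a field from a POINTWISE ROW FUNCTION (`√(Σ_z ω z²·hs(F z)) ≤ Ω·√(Σ_{z∈S} (B z)²)` — the profile twin of ✓p679067 §1, needed for gen-1's site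
# number `S₁` whose frame junk has a `(1 ∨ r)^{−1∕2}` radial profile that a uniform bound would overpay by `ℓ^{1∕2}`), (A2) the same for the FRAME JUNK `K := Δ_U(R(Fr)F) − R(Fr)Δ_flat F` of a
# frame-transported matrix field with pointwise cone rows `t₁ t₂` (over ✓p674125 `norm_covLaplace_framed_sub_flat_le`), (A3) the two radial profile sums `Σ(1∨r)⁻²`, `Σ(1∨r)⁻¹` packaged as
# squared-profile sums, (A4) the VECTOR-VALUED bump interpolant `ψ̃ z := Σ_y β_y z • a_y` of a datum `a : Site P k → V` living on the centres of a ball — px22 g3's ✓p679441 `bumpInterp_rows`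
# letter for letter with `‖·‖` for `|·|` (value at the centres, `‖ψ̃‖ ≤ D₀`, steps `≤ D₀B₁`, `‖Δ₁ψ̃‖ ≤ D₀B₂`, far vanishing with neighbours), over the «at most one active bump» bound in a normed space

Cell `ym3-torus`, width seat `ym3-torus-px11` (gen 4); routeR-w6 g7 LOCATE-GEN1 v1.0 §4 «FILE A → px11», px11 g4 LOCATE 00:20Z (D3)(D4).  THEOREMS ONLY (0 `def`, 0 `sorry`);
`--supports stmt-QuantumFields-19200`, count-neutral.  YM₃ on T³ is a ladder rung (R3), not the Clay problem; nothing here claims the stub, the crux, d = 4 or the gap.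

WHAT IS PROVED (ns `…Theorems.Prop7TransplantGen1Engines`; torus `Site P i`, `hs X = Σ_j Σ_k ‖X j k‖²`, flat Laplacian `Δ_flat F x = Σ_μ((F x − F(T_μx)) + (F x − F(T_μ⁻¹x)))`, `T = torusT P i`).
* §1 ★ `sqrt_weighted_hs_le_of_profile`, `sum_sq_add_le_two_mul` (`Σ(a+b)² ≤ 2Σa² + 2Σb²`), `sqrt_sum_sq_const` .
* §2 ★★ `sqrt_weighted_hs_frameJunk_le_of_profile` (pointwise `t₁ t₂`), ★ `frameJunk_eq_zero_of_vanish` (the junk vanishes where `F` and its neighbours vanish).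
* §3 `sum_sq_div_max_le` (`Σ_{S ⊆ ball(b,R)} (c∕(1∨r))² ≤ c²(8+192R)`), `sum_sq_sqrt_div_max_le` (`Σ (c·√(A∕(1∨r)))² ≤ c²A(8+128R²)`) — d = 3.
* §4 ★ `norm_sum_smul_le_of_disjoint`, `laplace_sum_smul_centres`, `sum_smul_apply_centre`, ★★ `bumpInterp_rows_smul`.
HONEST SCOPE.  Counting∕bookkeeping engines; gen-1's fields and numbers are FILES B∕C (routeR-w6 g7) and the member theorem (px22 g3).

References: T. Bałaban, CMP 96 (1984) 223–250 [Balaban1984PropagatorsII] ((1.9) p.226); CMP 99 (1985) 389–434 [Balaban1985BackgroundPropagators] ((3.8) p.392, (3.28) p.395, (3.35) p.396);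
CMP 99 (1985) 75–102 [Balaban1985RegularSpaces] ((1.14) p.78, (1.36) p.82).
-/

set_option autoImplicit false

noncomputable section

open scoped BigOperators Matrix.Norms.L2Operator Matrix
open Finset

namespace Summit.QuantumFields.YangMills.Theorems.Prop7TransplantGen1Engines

open Literature.MathematicalPhysics.QuantumFieldTheory.Balaban1983to89
open LatticeFieldCalculus (laplace)
open B9Eq39Adjoint (R R_def covD covDstar divB)
open B9TorusCalculus (torusT torusT_apply torusT_symm_apply)
open B15DeterminingSets (embIter)
open B3Taylor310LocalRemainder (tdist_comm tdist_self tdist_triangle)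
open Prop7PinnedKernelGeometry (tdist_le_tdist_shift_add_one tdist_le_tdist_unshift_add_one pow_le_tdist_embIter_of_ne)
open Prop7TransplantNorms (hs_R_le covLaplace_eq_zero_of_vanish)
open Prop7FramedScalarMatrix (norm_covLaplace_framed_sub_flat_le)
open Prop7HSOpNormSeam (sqrt_hs_le_sqrt_card_mul_norm)
open Prop7TorusGreenConvolution (sum_inv_max_sq_le sum_inv_max_le)
open Prop7TransplantBumpRows (abs_sum_mul_le_of_disjoint)

variable {P : Params} {i : ℕ} {N : ℕ}

/-! ## §1 ★ The weighted `ℓ²` number from a pointwise row function -/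

/-- ★ **WEIGHTED `ℓ²` FROM A POINTWISE PROFILE**: `F = 0` off `S`, `√hs(F z) ≤ B z` and `0 ≤ ω z ≤ Ω` on `S` ⇒ `√(Σ_z ω z²·hs(F z)) ≤ Ω·√(Σ_{z∈S} (B z)²)`.
[cite: Balaban1984PropagatorsII, (1.9) p.226] -/
theorem sqrt_weighted_hs_le_of_profile (S : Finset (Site P i)) (F : Site P i → Matrix (Fin N) (Fin N) ℂ) (hF : ∀ z ∉ S, F z = 0)
    (ω : Site P i → ℝ) {Ω : ℝ} (hω : ∀ z ∈ S, 0 ≤ ω z ∧ ω z ≤ Ω) (B : Site P i → ℝ)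
    (hB : ∀ z ∈ S, Real.sqrt (∑ j : Fin N, ∑ k : Fin N, ‖(F z) j k‖ ^ 2) ≤ B z) :
    Real.sqrt (∑ z, ω z ^ 2 * ∑ j : Fin N, ∑ k : Fin N, ‖(F z) j k‖ ^ 2) ≤ Ω * Real.sqrt (∑ z ∈ S, B z ^ 2) := by
  have hoff : ∀ z ∈ (univ : Finset (Site P i)), z ∉ S → ω z ^ 2 * ∑ j : Fin N, ∑ k : Fin N, ‖(F z) j k‖ ^ 2 = 0 := by
    intro z _ hz
    simp [hF z hz]
  rw [← Finset.sum_subset (Finset.subset_univ S) hoff]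
  have hle : ∑ z ∈ S, ω z ^ 2 * ∑ j : Fin N, ∑ k : Fin N, ‖(F z) j k‖ ^ 2 ≤ ∑ z ∈ S, Ω ^ 2 * B z ^ 2 := by
    refine Finset.sum_le_sum fun z hz => ?_
    have h0 : 0 ≤ ∑ j : Fin N, ∑ k : Fin N, ‖(F z) j k‖ ^ 2 := Finset.sum_nonneg fun _ _ => Finset.sum_nonneg fun _ _ => sq_nonneg _
    have hhs : ∑ j : Fin N, ∑ k : Fin N, ‖(F z) j k‖ ^ 2 ≤ B z ^ 2 := by
      rw [← Real.sq_sqrt h0]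
      exact pow_le_pow_left₀ (Real.sqrt_nonneg _) (hB z hz) 2
    exact mul_le_mul (pow_le_pow_left₀ (hω z hz).1 (hω z hz).2 2) hhs h0 (sq_nonneg _)
  rcases S.eq_empty_or_nonempty with hS0 | ⟨z₀, hz₀⟩
  · subst hS0
    rw [Finset.sum_empty, Real.sqrt_zero, Finset.sum_empty, Real.sqrt_zero, mul_zero]
  have hΩ : 0 ≤ Ω := (hω z₀ hz₀).1.trans (hω z₀ hz₀).2
  calc _ ≤ Real.sqrt (∑ z ∈ S, Ω ^ 2 * B z ^ 2) := Real.sqrt_le_sqrt hle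
    _ = Ω * Real.sqrt (∑ z ∈ S, B z ^ 2) := by
        rw [← Finset.mul_sum, Real.sqrt_mul (sq_nonneg Ω), Real.sqrt_sq hΩ]

/-- `Σ_{z∈S} (a z + b z)² ≤ 2·Σ a² + 2·Σ b²`. [folklore] -/
theorem sum_sq_add_le_two_mul (S : Finset (Site P i)) (a b : Site P i → ℝ) :
    ∑ z ∈ S, (a z + b z) ^ 2 ≤ 2 * ∑ z ∈ S, a z ^ 2 + 2 * ∑ z ∈ S, b z ^ 2 := by
  rw [Finset.mul_sum, Finset.mul_sum, ← Finset.sum_add_distrib]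
  refine Finset.sum_le_sum fun z _ => ?_
  nlinarith [sq_nonneg (a z - b z)]

/-- `√(Σ_{z∈S} c²) = √#S·|c|`. [folklore] -/
theorem sqrt_sum_sq_const (S : Finset (Site P i)) (c : ℝ) : Real.sqrt (∑ _z ∈ S, c ^ 2) = Real.sqrt S.card * |c| := by
  rw [Finset.sum_const, nsmul_eq_mul, Real.sqrt_mul (Nat.cast_nonneg _), Real.sqrt_sq_eq_abs]

/-- monotonicity letter: `B ≤ B'` pointwise on `S` and `0 ≤ B` ⇒ `√(Σ_S B²) ≤ √(Σ_S B'²)`. [folklore] -/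
theorem sqrt_sum_sq_mono (S : Finset (Site P i)) {B B' : Site P i → ℝ} (h0 : ∀ z ∈ S, 0 ≤ B z) (h : ∀ z ∈ S, B z ≤ B' z) :
    Real.sqrt (∑ z ∈ S, B z ^ 2) ≤ Real.sqrt (∑ z ∈ S, B' z ^ 2) :=
  Real.sqrt_le_sqrt (Finset.sum_le_sum fun z hz => pow_le_pow_left₀ (h0 z hz) (h z hz) 2)

/-! ## §2 ★★ The frame junk of a transported matrix field, weighted, from pointwise cone rows -/

/-- ★ **THE FRAME JUNK VANISHES WHERE THE FIELD AND ITS NEIGHBOURS VANISH**: `K z := Δ_U(R(Fr)F)(z) − R(Fr z)(Δ_flat F z) = 0` if `F z = F(T_μ^{±}z) = 0`. [cite: Balaban1985BackgroundPropagators, (3.8) p.392] -/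
theorem frameJunk_eq_zero_of_vanish (U : Fin P.d → Site P i → (Matrix (Fin N) (Fin N) ℂ)ˣ) (Fr : Site P i → (Matrix (Fin N) (Fin N) ℂ)ˣ)
    (F : Site P i → Matrix (Fin N) (Fin N) ℂ) (z : Site P i) (h0 : F z = 0) (h1 : ∀ μ, F (torusT P i μ z) = 0) (h2 : ∀ μ, F ((torusT P i μ).symm z) = 0) :
    divB (torusT P i) U (fun μ => covD (torusT P i) U μ (fun y => R (Fr y) (F y))) z
      - R (Fr z) (∑ μ : Fin P.d, ((F z - F (torusT P i μ z)) + (F z - F ((torusT P i μ).symm z)))) = 0 := by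
  rw [covLaplace_eq_zero_of_vanish U _ z (by show R _ (F z) = 0; rw [h0, R_def, mul_zero, zero_mul])
    (fun μ => by show R _ (F _) = 0; rw [h1 μ, R_def, mul_zero, zero_mul]) (fun μ => by show R _ (F _) = 0; rw [h2 μ, R_def, mul_zero, zero_mul])]
  simp only [h0, h1, h2, sub_self, add_zero, Finset.sum_const_zero, R_def, mul_zero, zero_mul]

/-- ★★ **THE WEIGHTED NUMBER OF THE FRAME JUNK FROM POINTWISE CONE ROWS** (row FUNCTIONS `t₁ t₂` on `S`, `F` vanishing with its neighbours off `S`, `0 ≤ ω ≤ Ω` on `S`): for `K` bound by its defining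
equation `hK`, `√(Σ_z ω z²·hs(K z)) ≤ Ω·√N·√(Σ_{z∈S} (Σ_μ[(2t₂ z + 4(t₁ z)²)‖F z‖ + 2t₁ z‖F(T_μz) − F z‖ + 2t₁ z‖F(T_μ⁻¹z) − F z‖])²)`.
[cite: Balaban1985BackgroundPropagators, (3.8) p.392, (3.28) p.395, (3.35) p.396; Balaban1984PropagatorsII, (1.9) p.226] -/
theorem sqrt_weighted_hs_frameJunk_le_of_profile (U : Fin P.d → Site P i → (Matrix (Fin N) (Fin N) ℂ)ˣ) (Fr : Site P i → (Matrix (Fin N) (Fin N) ℂ)ˣ)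
    (hU : ∀ (κ : Fin P.d) (y : Site P i), ‖(U κ y : Matrix (Fin N) (Fin N) ℂ)‖ ≤ 1 ∧ ‖(((U κ y)⁻¹ : (Matrix (Fin N) (Fin N) ℂ)ˣ) : Matrix (Fin N) (Fin N) ℂ)‖ ≤ 1)
    (hFr : ∀ z : Site P i, ‖(Fr z : Matrix (Fin N) (Fin N) ℂ)‖ ≤ 1 ∧ ‖(((Fr z)⁻¹ : (Matrix (Fin N) (Fin N) ℂ)ˣ) : Matrix (Fin N) (Fin N) ℂ)‖ ≤ 1)
    (F : Site P i → Matrix (Fin N) (Fin N) ℂ) (S : Finset (Site P i))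
    (hS : ∀ z ∉ S, F z = 0 ∧ (∀ μ, F (torusT P i μ z) = 0) ∧ ∀ μ, F ((torusT P i μ).symm z) = 0)
    (t₁ t₂ : Site P i → ℝ)
    (h1 : ∀ z ∈ S, ∀ μ, ‖(((Fr z)⁻¹ * U μ z * Fr (torusT P i μ z) : (Matrix (Fin N) (Fin N) ℂ)ˣ) : Matrix (Fin N) (Fin N) ℂ) - 1‖ ≤ t₁ z)
    (h1' : ∀ z ∈ S, ∀ μ, ‖(((Fr ((torusT P i μ).symm z))⁻¹ * U μ ((torusT P i μ).symm z) * Fr (torusT P i μ ((torusT P i μ).symm z)) : (Matrix (Fin N) (Fin N) ℂ)ˣ) :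
      Matrix (Fin N) (Fin N) ℂ) - 1‖ ≤ t₁ z)
    (h2 : ∀ z ∈ S, ∀ μ, ‖(((Fr z)⁻¹ * U μ z * Fr (torusT P i μ z) : (Matrix (Fin N) (Fin N) ℂ)ˣ) : Matrix (Fin N) (Fin N) ℂ)
      - (((Fr ((torusT P i μ).symm z))⁻¹ * U μ ((torusT P i μ).symm z) * Fr (torusT P i μ ((torusT P i μ).symm z)) : (Matrix (Fin N) (Fin N) ℂ)ˣ) :
        Matrix (Fin N) (Fin N) ℂ)‖ ≤ t₂ z)
    (K : Site P i → Matrix (Fin N) (Fin N) ℂ)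
    (hK : ∀ z, K z = divB (torusT P i) U (fun μ => covD (torusT P i) U μ (fun y => R (Fr y) (F y))) z
      - R (Fr z) (∑ μ : Fin P.d, ((F z - F (torusT P i μ z)) + (F z - F ((torusT P i μ).symm z)))))
    (ω : Site P i → ℝ) {Ω : ℝ} (hω : ∀ z ∈ S, 0 ≤ ω z ∧ ω z ≤ Ω) :
    Real.sqrt (∑ z, ω z ^ 2 * ∑ j : Fin N, ∑ k : Fin N, ‖(K z) j k‖ ^ 2)
      ≤ Ω * (Real.sqrt N * Real.sqrt (∑ z ∈ S,
          (∑ μ : Fin P.d, ((2 * t₂ z + 4 * t₁ z ^ 2) * ‖F z‖ + 2 * t₁ z * ‖F (torusT P i μ z) - F z‖ + 2 * t₁ z * ‖F ((torusT P i μ).symm z) - F z‖)) ^ 2)) := by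
  set J : Site P i → ℝ := fun z => ∑ μ : Fin P.d, ((2 * t₂ z + 4 * t₁ z ^ 2) * ‖F z‖ + 2 * t₁ z * ‖F (torusT P i μ z) - F z‖ + 2 * t₁ z * ‖F ((torusT P i μ).symm z) - F z‖) with hJdef
  have hK0 : ∀ z ∉ S, K z = 0 := by
    intro z hz
    obtain ⟨h0, hs, hu⟩ := hS z hz
    rw [hK z]
    exact frameJunk_eq_zero_of_vanish U Fr F z h0 hs hu
  have hpt : ∀ z ∈ S, Real.sqrt (∑ j : Fin N, ∑ k : Fin N, ‖(K z) j k‖ ^ 2) ≤ Real.sqrt N * J z := by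
    intro z hz
    refine (sqrt_hs_le_sqrt_card_mul_norm (K z)).trans (mul_le_mul_of_nonneg_left ?_ (Real.sqrt_nonneg _))
    rw [hK z]
    exact norm_covLaplace_framed_sub_flat_le (torusT P i) U Fr hU hFr F z (h1 z hz) (h1' z hz) (h2 z hz)
  have h := sqrt_weighted_hs_le_of_profile S K hK0 ω hω (fun z => Real.sqrt N * J z) hpt
  refine h.trans (le_of_eq ?_)
  have e : ∑ z ∈ S, (Real.sqrt N * J z) ^ 2 = (N : ℝ) * ∑ z ∈ S, J z ^ 2 := by
    rw [Finset.mul_sum]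
    exact Finset.sum_congr rfl fun z _ => by rw [mul_pow, Real.sq_sqrt (Nat.cast_nonneg _)]
  rw [e, Real.sqrt_mul (Nat.cast_nonneg _)]

/-- the junk row function is nonnegative on `S` (the cone rows force `0 ≤ t₁ z`, `0 ≤ t₂ z`). [folklore] -/
theorem frameJunk_profile_nonneg (U : Fin P.d → Site P i → (Matrix (Fin N) (Fin N) ℂ)ˣ) (Fr : Site P i → (Matrix (Fin N) (Fin N) ℂ)ˣ)
    (F : Site P i → Matrix (Fin N) (Fin N) ℂ) (z : Site P i) (t₁ t₂ : Site P i → ℝ)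
    (h1 : ∀ μ, ‖(((Fr z)⁻¹ * U μ z * Fr (torusT P i μ z) : (Matrix (Fin N) (Fin N) ℂ)ˣ) : Matrix (Fin N) (Fin N) ℂ) - 1‖ ≤ t₁ z)
    (h2 : ∀ μ, ‖(((Fr z)⁻¹ * U μ z * Fr (torusT P i μ z) : (Matrix (Fin N) (Fin N) ℂ)ˣ) : Matrix (Fin N) (Fin N) ℂ)
      - (((Fr ((torusT P i μ).symm z))⁻¹ * U μ ((torusT P i μ).symm z) * Fr (torusT P i μ ((torusT P i μ).symm z)) : (Matrix (Fin N) (Fin N) ℂ)ˣ) :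
        Matrix (Fin N) (Fin N) ℂ)‖ ≤ t₂ z) :
    0 ≤ ∑ μ : Fin P.d, ((2 * t₂ z + 4 * t₁ z ^ 2) * ‖F z‖ + 2 * t₁ z * ‖F (torusT P i μ z) - F z‖ + 2 * t₁ z * ‖F ((torusT P i μ).symm z) - F z‖) := by
  obtain ⟨μ₀⟩ := (inferInstance : Nonempty (Fin P.d))
  have ht₁ : 0 ≤ t₁ z := (norm_nonneg _).trans (h1 μ₀)
  have ht₂ : 0 ≤ t₂ z := (norm_nonneg _).trans (h2 μ₀)
  exact Finset.sum_nonneg fun μ _ => by positivity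

/-! ## §3 Radial profile sums (d = 3) -/

/-- `Σ_{z∈S} (c ∕ (1∨tdist z b))² ≤ c²·(8 + 192R)` for `S ⊆ {tdist(·,b) ≤ R}`. [folklore] -/
theorem sum_sq_div_max_le (hd : P.d = 3) (S : Finset (Site P i)) (b : Site P i) (R : ℕ) (hS : ∀ z ∈ S, Site.tdist z b ≤ R) (c : ℝ) :
    ∑ z ∈ S, (c / max 1 ((Site.tdist z b : ℕ) : ℝ)) ^ 2 ≤ c ^ 2 * (8 + 192 * (R : ℝ)) := by
  have h := sum_inv_max_sq_le hd S b R hS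
  have e : ∑ z ∈ S, (c / max 1 ((Site.tdist z b : ℕ) : ℝ)) ^ 2 = c ^ 2 * ∑ z ∈ S, ((max 1 ((Site.tdist z b : ℕ) : ℝ)) ^ 2)⁻¹ := by
    rw [Finset.mul_sum]
    exact Finset.sum_congr rfl fun z _ => by rw [div_pow, div_eq_mul_inv]
  rw [e]
  exact mul_le_mul_of_nonneg_left h (sq_nonneg c)

/-- `Σ_{z∈S} (c·√(A ∕ (1∨tdist z b)))² ≤ c²·A·(8 + 128R²)` for `S ⊆ {tdist(·,b) ≤ R}`, `0 ≤ A`. [folklore] -/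
theorem sum_sq_sqrt_div_max_le (hd : P.d = 3) (S : Finset (Site P i)) (b : Site P i) (R : ℕ) (hS : ∀ z ∈ S, Site.tdist z b ≤ R) (c : ℝ) {A : ℝ} (hA : 0 ≤ A) :
    ∑ z ∈ S, (c * Real.sqrt (A / max 1 ((Site.tdist z b : ℕ) : ℝ))) ^ 2 ≤ c ^ 2 * A * (8 + 128 * (R : ℝ) ^ 2) := by
  have h := sum_inv_max_le hd S b R hS
  have e : ∑ z ∈ S, (c * Real.sqrt (A / max 1 ((Site.tdist z b : ℕ) : ℝ))) ^ 2 = c ^ 2 * A * ∑ z ∈ S, (max 1 ((Site.tdist z b : ℕ) : ℝ))⁻¹ := by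
    rw [Finset.mul_sum]
    refine Finset.sum_congr rfl fun z _ => ?_
    have hm : 0 < max 1 ((Site.tdist z b : ℕ) : ℝ) := lt_of_lt_of_le one_pos (le_max_left _ _)
    rw [mul_pow, Real.sq_sqrt (div_nonneg hA hm.le), div_eq_mul_inv, mul_assoc]
  rw [e]
  exact mul_le_mul_of_nonneg_left h (by positivity)

/-! ## §4 ★★ The vector-valued bump interpolant -/

section Bumps

variable {V : Type*} [NormedAddCommGroup V] [NormedSpace ℝ V]

/-- ★ **AT MOST ONE ACTIVE TERM, VECTOR COEFFICIENTS**: if `a_y = 0` off `Y₀`, `‖a_y‖ ≤ D₀`, `f_y = 0` off `S_y`, `|f_y| ≤ B`, and the `S_y` (`y ∈ Y₀`) are pairwise disjoint, then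
`‖Σ_y f_y z • a_y‖ ≤ D₀·B` at every `z`, and the sum vanishes unless `z ∈ S_y` for some `y ∈ Y₀`. [cite: Balaban1985RegularSpaces, (1.14) p.78] -/
theorem norm_sum_smul_le_of_disjoint {Y : Type*} [Fintype Y] (a : Y → V) (f : Y → Site P 0 → ℝ) (S : Y → Finset (Site P 0)) (Y₀ : Finset Y) {D₀ B : ℝ}
    (hD₀ : 0 ≤ D₀) (hB : 0 ≤ B) (ha0 : ∀ y ∉ Y₀, a y = 0) (haD : ∀ y, ‖a y‖ ≤ D₀)
    (hfS : ∀ y z, z ∉ S y → f y z = 0) (hfB : ∀ y z, |f y z| ≤ B)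
    (hdisj : ∀ y ∈ Y₀, ∀ y' ∈ Y₀, y ≠ y' → Disjoint (S y) (S y')) (z : Site P 0) :
    ‖∑ y, f y z • a y‖ ≤ D₀ * B ∧ ((∀ y ∈ Y₀, z ∉ S y) → ∑ y, f y z • a y = 0) := by
  classical
  have hvan : ∀ y, y ∉ Y₀.filter (fun y => z ∈ S y) → f y z • a y = 0 := by
    intro y hy
    rw [Finset.mem_filter, not_and] at hy
    by_cases hy0 : y ∈ Y₀
    · rw [hfS y z (hy hy0), zero_smul]
    · rw [ha0 y hy0, smul_zero]
  have hrestrict : ∑ y, f y z • a y = ∑ y ∈ Y₀.filter (fun y => z ∈ S y), f y z • a y := by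
    rw [← Finset.sum_subset (Finset.subset_univ _)]
    intro y _ hy
    exact hvan y hy
  have hcard : (Y₀.filter (fun y => z ∈ S y)).card ≤ 1 := by
    rw [Finset.card_le_one]
    intro y hy y' hy'
    rw [Finset.mem_filter] at hy hy'
    by_contra h
    exact Finset.disjoint_left.mp (hdisj y hy.1 y' hy'.1 h) hy.2 hy'.2
  refine ⟨?_, fun hz => ?_⟩
  · rw [hrestrict]
    calc ‖∑ y ∈ Y₀.filter (fun y => z ∈ S y), f y z • a y‖
        ≤ ∑ y ∈ Y₀.filter (fun y => z ∈ S y), ‖f y z • a y‖ := norm_sum_le _ _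
      _ ≤ ∑ _y ∈ Y₀.filter (fun y => z ∈ S y), D₀ * B := Finset.sum_le_sum fun y _ => by
          rw [norm_smul, Real.norm_eq_abs, mul_comm]
          exact mul_le_mul (haD y) (hfB y z) (abs_nonneg _) hD₀
      _ = (Y₀.filter (fun y => z ∈ S y)).card * (D₀ * B) := by rw [Finset.sum_const, nsmul_eq_mul]
      _ ≤ 1 * (D₀ * B) := mul_le_mul_of_nonneg_right (by exact_mod_cast hcard) (by positivity)
      _ = D₀ * B := one_mul _
  · rw [hrestrict]
    have hempty : Y₀.filter (fun y => z ∈ S y) = ∅ := by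
      rw [Finset.filter_eq_empty_iff]
      intro y hy
      exact hz y hy
    rw [hempty, Finset.sum_empty]

/-- `Δ_c(x ↦ Σ_y β_y x • a_y) z = Σ_y (Δ_c β_y z) • a_y` (finite index of centres). [cite: Balaban1984PropagatorsI, (1.21) p.21] -/
theorem laplace_sum_smul_centres {Y : Type*} [Fintype Y] {j : ℕ} (c : ℝ) (a : Y → V) (β : Y → SiteField P j ℝ) (z : Site P j) :
    laplace c (fun x => ∑ y, β y x • a y) z = ∑ y, (laplace c (β y) z) • a y := by
  simp only [laplace, smul_eq_mul, Finset.sum_smul]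
  rw [Finset.sum_comm]
  refine Finset.sum_congr rfl fun y _ => ?_
  simp only [Finset.smul_sum, smul_add, smul_sub, ← Finset.sum_add_distrib, ← Finset.sum_sub_distrib]
  refine Finset.sum_congr rfl fun μ _ => ?_
  rw [mul_sub, mul_sub, mul_add, sub_smul, sub_smul, add_smul, smul_smul, smul_smul, smul_smul]

/-- `ψ̃(e_y) = a_y` when `β_y(e_y) = 1` and `β_{y′}(e_y) = 0` for `y′ ≠ y`. [folklore] -/
theorem sum_smul_apply_centre {Y : Type*} [Fintype Y] [DecidableEq Y] {j : ℕ} (a : Y → V) (β : Y → SiteField P j ℝ) (e : Y → Site P j)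
    (hβ1 : ∀ y, β y (e y) = 1) (hβ0 : ∀ y y', y ≠ y' → β y (e y') = 0) (y : Y) :
    ∑ y', β y' (e y) • a y' = a y := by
  rw [Finset.sum_eq_single y]
  · rw [hβ1, one_smul]
  · intro y' _ hy'
    rw [hβ0 y' y hy', zero_smul]
  · intro h; exact absurd (Finset.mem_univ y) h

/-- ★★ **THE VECTOR-VALUED BUMP INTERPOLANT** `ψ̃ z := Σ_y β_y z • a_y` (bumps of ✓ `exists_bump_rows`; `‖a‖ ≤ D₀`, `a_y = 0` unless `tdist(e_y, b) < R`): `ψ̃(e_y) = a_y`; `‖ψ̃‖ ≤ D₀`;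
`‖ψ̃(z ± e_μ) − ψ̃ z‖ ≤ D₀·B₁`; `‖Δ₁ψ̃ z‖ ≤ D₀·B₂`; and `ψ̃ z = ψ̃(z ± e_μ) = 0` whenever `tdist(z, b) ≥ R + r_S + 2` — px22 g3's ✓ `bumpInterp_rows` with vector coefficients.
[cite: Balaban1985RegularSpaces, (1.14) p.78, (1.36) p.82] -/
theorem bumpInterp_rows_smul [DecidableEq (Site P 0)] {k : ℕ} (hk : k ≤ P.m + P.K)
    (β : Site P k → Site P 0 → ℝ) {B₁ B₂ : ℝ} {rS : ℕ} (hsep : 2 * rS + 3 ≤ P.L ^ k)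
    (hβ1 : ∀ y, β y (embIter k y) = 1) (hβ01 : ∀ y z, 0 ≤ β y z ∧ β y z ≤ 1) (hβ0 : ∀ y z, rS < Site.tdist z (embIter k y) → β y z = 0)
    (hβd : ∀ y z μ, |β y (z.shift μ) - β y z| ≤ B₁ ∧ |β y (z.unshift μ) - β y z| ≤ B₁) (hβL : ∀ y z, |laplace 1 (β y) z| ≤ B₂)
    (a : Site P k → V) (b : Site P 0) {R : ℕ} {D₀ : ℝ} (hD₀ : 0 ≤ D₀) (haD : ∀ y, ‖a y‖ ≤ D₀) (ha0 : ∀ y, R ≤ Site.tdist (embIter k y) b → a y = 0) :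
    (∀ y, ∑ y', β y' (embIter k y) • a y' = a y) ∧
    (∀ z, ‖∑ y, β y z • a y‖ ≤ D₀) ∧
    (∀ z μ, ‖∑ y, β y (z.shift μ) • a y - ∑ y, β y z • a y‖ ≤ D₀ * B₁ ∧ ‖∑ y, β y (z.unshift μ) • a y - ∑ y, β y z • a y‖ ≤ D₀ * B₁) ∧
    (∀ z, ‖laplace 1 (fun x => ∑ y, β y x • a y) z‖ ≤ D₀ * B₂) ∧
    (∀ z, R + rS + 2 ≤ Site.tdist z b → (∑ y, β y z • a y) = 0 ∧ (∀ μ, (∑ y, β y (z.shift μ) • a y) = 0) ∧ ∀ μ, (∑ y, β y (z.unshift μ) • a y) = 0) := by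
  classical
  -- the active centres and their balls
  set Y₀ : Finset (Site P k) := univ.filter fun y => Site.tdist (embIter k y) b < R with hY₀
  set S : Site P k → Finset (Site P 0) := fun y => univ.filter fun z => Site.tdist z (embIter k y) ≤ rS + 1 with hS
  have ha0' : ∀ y ∉ Y₀, a y = 0 := fun y hy => ha0 y (by rw [hY₀, Finset.mem_filter, not_and] at hy; exact not_lt.1 (hy (Finset.mem_univ y)))
  have hmemS : ∀ y z, z ∈ S y ↔ Site.tdist z (embIter k y) ≤ rS + 1 := fun y z => by rw [hS]; simp only [Finset.mem_filter, Finset.mem_univ, true_and]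
  have hdisj : ∀ y ∈ Y₀, ∀ y' ∈ Y₀, y ≠ y' → Disjoint (S y) (S y') := by
    intro y _ y' _ hyy'
    rw [Finset.disjoint_left]
    intro z hz hz'
    rw [hmemS] at hz hz'
    have hfar := pow_le_tdist_embIter_of_ne hk hyy'
    have htri := tdist_triangle (embIter k y) z (embIter k y')
    rw [tdist_comm (embIter k y) z] at htri
    omega
  -- the three families vanish off `S y`
  have hval0 : ∀ y z, z ∉ S y → β y z = 0 := fun y z hz => hβ0 y z (by rw [hmemS] at hz; omega)
  have hsh0 : ∀ μ y z, z ∉ S y → β y (z.shift μ) - β y z = 0 := by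
    intro μ y z hz
    rw [hmemS] at hz
    have := tdist_le_tdist_shift_add_one z (embIter k y) μ
    rw [hβ0 y z (by omega), hβ0 y (z.shift μ) (by omega), sub_zero]
  have hush0 : ∀ μ y z, z ∉ S y → β y (z.unshift μ) - β y z = 0 := by
    intro μ y z hz
    rw [hmemS] at hz
    have := tdist_le_tdist_unshift_add_one z (embIter k y) μ
    rw [hβ0 y z (by omega), hβ0 y (z.unshift μ) (by omega), sub_zero]
  have hlap0 : ∀ y z, z ∉ S y → laplace 1 (β y) z = 0 := by
    intro y z hz
    rw [hmemS] at hz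
    simp only [laplace, one_pow, one_smul]
    refine Finset.sum_eq_zero fun μ _ => ?_
    have h1 := tdist_le_tdist_shift_add_one z (embIter k y) μ
    have h2 := tdist_le_tdist_unshift_add_one z (embIter k y) μ
    rw [hβ0 y z (by omega), hβ0 y (z.shift μ) (by omega), hβ0 y (z.unshift μ) (by omega)]; ring
  have hβabs : ∀ y z, |β y z| ≤ 1 := fun y z => abs_le.2 ⟨by linarith [(hβ01 y z).1], (hβ01 y z).2⟩
  obtain ⟨y₀⟩ : Nonempty (Site P k) := ⟨default⟩
  obtain ⟨μ₀⟩ : Nonempty (Fin P.d) := inferInstance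
  have hB₁0 : 0 ≤ B₁ := (abs_nonneg _).trans (hβd y₀ b μ₀).1
  have hB₂0 : 0 ≤ B₂ := (abs_nonneg _).trans (hβL y₀ b)
  refine ⟨fun y => ?_, fun z => ?_, fun z μ => ⟨?_, ?_⟩, fun z => ?_, fun z hz => ?_⟩
  · -- value at a centre
    refine sum_smul_apply_centre a β (embIter k) hβ1 (fun y y' hyy' => hβ0 y _ ?_) y
    have := pow_le_tdist_embIter_of_ne hk hyy'.symm
    omega
  · have h := (norm_sum_smul_le_of_disjoint a β S Y₀ hD₀ zero_le_one ha0' haD hval0 hβabs hdisj z).1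
    simpa only [mul_one] using h
  · rw [← Finset.sum_sub_distrib]
    have e : ∑ y, (β y (z.shift μ) • a y - β y z • a y) = ∑ y, (β y (z.shift μ) - β y z) • a y := Finset.sum_congr rfl fun y _ => by rw [sub_smul]
    rw [e]
    exact (norm_sum_smul_le_of_disjoint a (fun y z => β y (z.shift μ) - β y z) S Y₀ hD₀ hB₁0 ha0' haD (hsh0 μ) (fun y z => (hβd y z μ).1) hdisj z).1
  · rw [← Finset.sum_sub_distrib]
    have e : ∑ y, (β y (z.unshift μ) • a y - β y z • a y) = ∑ y, (β y (z.unshift μ) - β y z) • a y := Finset.sum_congr rfl fun y _ => by rw [sub_smul]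
    rw [e]
    exact (norm_sum_smul_le_of_disjoint a (fun y z => β y (z.unshift μ) - β y z) S Y₀ hD₀ hB₁0 ha0' haD (hush0 μ) (fun y z => (hβd y z μ).2) hdisj z).1
  · rw [laplace_sum_smul_centres]
    exact (norm_sum_smul_le_of_disjoint a (fun y z => laplace 1 (β y) z) S Y₀ hD₀ hB₂0 ha0' haD hlap0 hβL hdisj z).1
  · -- far from `b`: no active ball contains `z` or its neighbours
    have hfar : ∀ w : Site P 0, R + rS + 1 ≤ Site.tdist w b → ∀ y ∈ Y₀, w ∉ S y := by
      intro w hw y hy hwS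
      rw [hY₀, Finset.mem_filter] at hy
      rw [hmemS] at hwS
      have htri := tdist_triangle w (embIter k y) b
      omega
    refine ⟨(norm_sum_smul_le_of_disjoint a β S Y₀ hD₀ zero_le_one ha0' haD hval0 hβabs hdisj z).2 (hfar z (by omega)), fun μ => ?_, fun μ => ?_⟩
    · have := tdist_le_tdist_shift_add_one z b μ
      exact (norm_sum_smul_le_of_disjoint a β S Y₀ hD₀ zero_le_one ha0' haD hval0 hβabs hdisj (z.shift μ)).2 (hfar _ (by omega))
    · have := tdist_le_tdist_unshift_add_one z b μ
      exact (norm_sum_smul_le_of_disjoint a β S Y₀ hD₀ zero_le_one ha0' haD hval0 hβabs hdisj (z.unshift μ)).2 (hfar _ (by omega))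

end Bumps

end Summit.QuantumFields.YangMills.Theorems.Prop7TransplantGen1Engines

end
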